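import Mathlib
import HarnessLib
import HarnessLib.Audit
import Summits.AtomisticToContinuum.Statement
import HarnessLib.Audit.Status.Attr

/-!
Route: ResponseRigidity

DORMANT since 2026-08-23T09:38:06Z (reconciler: no traction for 6 d (last activity statement-grounded at 2026-08-17T07:59:05Z); parked, not closed — `ledger route dormant route-AtomisticToContinuum-ResponseRigidity --off` to reactivate) — unstaffed, not closed; items shared with open routes are served there. `ledger route dormant <id> --off` reactivates.

# Route ResponseRigidity — Boltzmann's collision-invariant rigidity on the one-sphere response, fed
through a one-collision Palm renewal, decides Euler in the mean

It suffices to show X = SlavedContactSynergy ∧ CLTScaleConcentration ∧ RenewalDefect (plus the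
rule-crux EngineReduction and the shared dock MeanClosure; since the 2026-08-16 re-type of the
conjunct (p126922, packing-guarded
`_root_.HydrodynamicLimit`) the packing guard is a HYPOTHESIS of the conjunct and
DiluteSelfConsistency (stmt-3091) has left the route).
Along the Euler family of local Gibbs laws LG_τ = localGibbsLaw σ (a τ) (u τ) (θ τ) (the activity
family a_τ pinned to the classical solution,
support EulerProfileFamily), let Y = ⟨U_N(Φ_s ·), χ⟩ be a far-future tested conserved field and μ₁ =
(N+1)(E[Y | z₀] − EY) the ONE-SPHERE
RESPONSE. X says: (C1, rank 2) the OUTGOING-CONTACT PAIR SYNERGY (N+1)[E(Y|z₀,z₁) − E(Y|z₀) −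
E(Y|z₁) + EY], paired under the incoming-contact
flux measure of LG_τ against collision differences ψ(v₀) − ψ(v₀') of any ⊥-test function ψ (⊥ to the
collision invariants 1, v, |v|²), is
SLAVED to the non-hydrodynamic part of μ₁ with a constant that vanishes with the packing band; (C2,
rank 3) the fields have CLT-scale variance
O(1/N) under LG_τ (concentration WITHOUT identification of the mean); (C3, rank 4) the ψ-weighted
one-sphere covariance is intertwined along one
step of d mean free times (an identity at constant profiles). The ENGINE (support RigidityTransfer):
an exact one-collision Palm/Campbell
renewal identity turns C1–C3 into ⟨ψ, L_eff μ₁⟩ → 0 for the LINEARISED hard-sphere Boltzmann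
operator L (partner term included), and
Boltzmann's rigidity ker L = span{1,v,|v|²} + spectral gap + absorption force μ₁ to be hydrodynamic
(HydrodynamicSufficiency); the exact score
identities (Kawasaki/TTCF in s, exponential family in τ) and Yau's cancellation then give the
flow-box decoupling of the two-parameter mean map,
the antidiagonal telescope gives Euler in the mean (target MeanHydroLimitInBand, shared stmt-11927),
entropy saturation (MeanClosure, stmt-11929)
gives probability; the packing guard is the conjunct's own hypothesis (re-type p126922), consumed
directly in `closes`. No card is realised as spine; the dock realises the content of cards
transient-covariance-identity (its crux 1 in regression-projected, means-only form = support
FlowBoxDecoupling) and entropy-saturation-mean-closure.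
Lean: `SlavedContactSynergy ∧ CLTScaleConcentration ∧ RenewalDefect`

## Assembly
Pure logic over CRUXES ONLY (glue.lean `closes`, lean check rc 0 in Sketch.lean, axioms propext /
Classical.choice / Quot.sound): X_mean :=
EngineReduction C1 C2 C3 : MeanHydroLimitInBand; the conjunct's packing threshold is η₀ := min η₁ η₂
of the two bands (X_mean's and MeanClosure's),
σ₀ := min σ₁ σ₂; the conjunct's guard ρ_t(x)σ³ < η₀ (a hypothesis since the re-type p126922) feeds
both items' guards, means from X_mean,
MeanClosure turns them into TendstoHydroFieldsAt at t — the body of the packing-guarded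
`_root_.HydrodynamicLimit`; DiluteSelfConsistency
(stmt-3091) is no longer a hypothesis of `closes` and was dropped from the route (repair
2026-08-16). EngineReduction itself is the composition MeansByCharacteristics ∘ SufficiencyToFlowBox
∘ RigidityTransfer
with MeanMapRegularity and EulerProfileFamily (all typed supports), which is how provers are meant
to discharge it.

Rationale: WHY THIS LINE. Every closure engine on the board must explain why, after N^{1/3} collision times,
only five one-body directions survive; they do it by
identifying a response (OneSphereInfluence, AthermalClockWard), by contracting information along the
collision DAG over macroscopic times
(InformationPercolationEngine), by resumming ring histories (BallisticLaceBootstrap), by commutator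
estimates on Ker(Koopman)
(MourreKoopmanCharges) or by classifying stationary states (UGibbsSRBRigidity, PesinPricing). Here
the five-dimensionality is Boltzmann's 1872
theorem — the kernel of the LINEARISED collision operator is span{1, v, |v|²} (CIP1994 §3.1–3.3; gap
BarangerMouhot2005, Mouhot2006; tree:
Hilbert6LinearizedBoltzmann) — applied not to a velocity distribution but to the RESPONSE FUNCTION
μ₁ of the far-future macroscopic field to
one sphere's present state, through an EXACT one-collision renewal identity: by the Campbell/Palm
formula for the stationary point process of
collisions of a tagged sphere (Bremaud2020 Ch. 17; LastPenrose2017 Ch. 9; collision flux measure of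
the hard-ball flow, ChernovMarkarian2006,
GST2013), C^ψ(s) − C^ψ(s−r) = −(N+1)λr·E_Palm[(ψ(v⁺)−ψ(v⁻))Y]; the macroscopic-time accumulation
that kills every kinetic expansion
(Literature.Barriers.AtomisticToContinuum.NoDensityExpansionBarrier) is ABSORBED into the unknown μ₁
itself, of which only the L² norm is used
(free from C2 by Bessel/Efron–Stein, EfronStein1981, Duerinckx2021), and the symmetrised flux
pairing E_flux[(ψ(v)−ψ(v'))(μ(v')+μ(w'))] is
EXACTLY ⟨ψ, Lμ⟩ (the partner's response μ(w') − μ(w) is what upgrades the tagged operator, kernel =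
constants, to the linearised one, kernel =
five invariants). At constant profiles (invariant Gibbs law) C2 and C3 are FREE (stationarity:
static variances, exact time shift), and the engine
is a conditional theorem checked on paper: SlavedContactSynergy_eq ⇒ every ⊥ one-body sum
decorrelates from every future conserved field on Euler
times — the ⊥-half of Spohn's Euler-scale correlation conjecture (Spohn1991 §7.1 (7.13)–(7.19), §7.2
(7.45): "projection of the total currents
onto the five-dimensional invariant subspace") — with three sanity checks built in: the identity is
void for the ideal gas (λ = 0, where the
decorrelation is false, Literature.Barriers.AtomisticToContinuum.BoltzmannHypothesisBarrier kernel),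
L ≡ 0 for the 1-D velocity-swap (hard-rod)
rule (no rigidity, kinetic limit instead, BoldrighiniDobrushinSukhov1983), and the slaving constant
is a convergent ring integral ∫dτ/τ² only in
d = 3 (log-divergent for disks). Imported areas: Palm calculus of stationary point processes
(probability), spectral theory of the linearised
Boltzmann operator (kinetic theory), Hoeffding/Efron–Stein decompositions (statistics), nonlinear
response identities (EvansMorriss2008 Ch. 7,
Sasa2014, Gaspard2022 §3.2) and Yau's relative-entropy algebra (Yau1991, OllaVaradhanYau1993) for
the dock. Physics precedent for "kinetic
equations for correlation functions": LebowitzPercusSykes1969 (formal, Enskog-type equations for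
equilibrium time correlations); nothing there
uses renewal + rigidity as a closing mechanism, and nothing on the board places L's kernel on μ₁.

RANKED CRUXES. #0 MeanHydroLimitInBand (target) — MEAN hydrodynamic limit in the dilute band (shared
typed waypoint, AthermalClockWard's stmt-11927): under the packing guard, the EXPECTATIONS of the
χ-tested empirical density / momentum / energy fields at every t < T converge to the Euler values.
(why it might fail: it is the guarded conjunct restricted to means (⇔ conjunct given MeanClosure):
fails iff local equilibrium fails to propagate in mean at fixed small σ pre-shock (Spohn1991 I.3;
OllaVaradhanYau1993 need noise).) [Spohn1991, OllaVaradhanYau1993]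
#2 SlavedContactSynergy (crux) — SLAVED CONTACT SYNERGY (the new load-bearing statement). Along
every Euler activity family, for every ⊥-test function ψ(q,v) = φ(q)·p((v − u_τ(q))/√θ_τ(q)) with p
⊥ {1, c, |c|²} under the standard Gaussian (unit L²(gauss) ball, quartic growth), every δ > 0 and s
∈ [δ, t], τ with s + τ ≤ t: the pairing, under the thickened incoming-contact flux measure of LG_τ
(normalised by its mass Z), of the collision difference ψ(v₀) − ψ(v₀') with the OUTGOING pair
synergy S∘collidePair, S = μ₂ − μ₁ − μ₁' ((N+1)-scaled conditional means of the far-future field Y =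
⟨U_N(Φ_s·),χ⟩ given (z₀,z₁), z₀, z₁), is bounded by ϵ·dist_{L²(LG_τ)}(μ₁, {α(q₀) + β(q₀)·v₀ +
γ(q₀)|v₀|²}) + κ' for N ≥ N₀(thickening), for EVERY ϵ > 0 once the packing band η(ϵ) is small:
synergy at outgoing contact is carried only by prompt re-encounter episodes, through which conserved
content passes additively, so only the ⊥-part of the response is visible to ⊥ collision differences,
with weight = re-encounter probability → 0 with the packing. [difficulty: open-problem] (why it
might fail: a hidden two-body (quasi-)conserved quantity, or O(1) cascade-merging synergy of contact
pairs beyond prompt re-encounters, gives unslaved synergy ≍ 1 at fixed σ; slaving constant may be ≍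
φ^a but not → 0 inside the admissible band; open even at constant profiles.) [Spohn1991, CIP1994,
BarangerMouhot2005, EfronStein1981, Duerinckx2021, LebowitzPercusSykes1969]
#3 CLTScaleConcentration (crux) — CLT-SCALE CONCENTRATION WITHOUT IDENTIFICATION. Along every Euler
activity family and for every smooth χ there is C with Var_{LG_τ}(⟨U_N(Φ_s·),χ⟩) ≤ C/(N+1) (density,
momentum components, energy; square integrable) for all N and all 0 ≤ s, τ with s + τ ≤ t: the
fields concentrate at the central-limit scale around their (unidentified) means. At s = 0 it is the
static local-Gibbs CLT bound; at constant profiles it is free by stationarity. It supplies ‖μ₁‖_{L²}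
= O(1) (Bessel) and the Lipschitz-in-lag step of the renewal. [difficulty: L] (why it might fail:
super-CLT fluctuations of conserved fields at fixed density pre-shock (an instability amplifying
thermal seeds before t, cf. the zero-horizon/Ehrenfest cards) would give Var ≫ 1/N at some s ≥ δ;
uniformity down to N small forces a large C only.) [Spohn1991, OllaVaradhanYau1993, Duerinckx2021]
#4 RenewalDefect (crux) — ONE-SPHERE RENEWAL DEFECT (the non-stationarity price; an identity at
constant profiles). For ψ(q,v) = φ(q)p(c) of quartic growth, δ ≤ s, s + τ ≤ t and the step r =
d(N+1)^{-1/3} (d mean free times up to constants): (N+1)·|E_{LG_τ}[ψ_τ(z₀(r))·(Y_s − EY_s)] −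
E_{LG_{τ+r}}[ψ_{τ+r}(z₀(0))·(Y_{s−r} − EY_{s−r})]| ≤ κ'·d for small d and N ≥ N₀(d): reading the
⊥-weight on sphere 0 after the step under LG_τ is the same, to o(d), as reading it at time 0 under
the Euler-advanced law with the horizon shortened — the time-shift that stationarity gives for free
at equilibrium. [difficulty: open-problem] (why it might fail: Φ_r#LG_τ and LG_{τ+r} are far apart
as measures (relative entropy ≍ d²N^{1/3}); the claim needs the ψ(z₀)·future-field observable to see
only the hydrodynamic part of that distortion — a three-point (⊥, one-sphere ⊥, future) additivity
that could fail at O(d).) [Yau1991, OllaVaradhanYau1993, Sasa2014, Gaspard2022]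
#5 EngineReduction (crux) — ENGINE REDUCTION (one crux BY RULE — only cruxes may feed `closes`; its
proof is the composition of the typed supports RigidityTransfer, SufficiencyToFlowBox and
MeansByCharacteristics with the statics/regularity supports MeanMapRegularity and EulerProfileFamily
proved as lemmas): SlavedContactSynergy → CLTScaleConcentration → RenewalDefect →
MeanHydroLimitInBand. Renewal + rigidity + absorption give hydrodynamic sufficiency of the
one-sphere response; the score identities and Yau's cancellation give the flow-box decoupling; the
antidiagonal telescope, paid at the initial layer by short-time regularity of the mean map along the
Euler activity family, gives Euler in the mean in the dilute band. [deps: SlavedContactSynergy,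
CLTScaleConcentration, RenewalDefect] [difficulty: L] (why it might fail: fails where its supports
do: Palm/Campbell calculus of the tagged collision process under NON-invariant local Gibbs laws, the
contact-flux form of the collisional score with the virial identification of its hydro projection,
or the canonical cluster-expansion statics.) [Yau1991, OllaVaradhanYau1993, BarangerMouhot2005,
Bremaud2020, LastPenrose2017, Spohn1991]
#6 MeanClosure (crux) — MEAN ⇒ PROBABILITY BY ENTROPY SATURATION (shared item stmt-11929 of
AthermalClockWard, identical signature): under the packing guard, if the expectations of the tested
fields converge to the Euler values at t then TendstoHydroFieldsAt holds at t (Liouville-invariant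
Shannon entropy, log of the local Gibbs density linear in the fields, isentropy of classical
hs-Euler, exponential concentration of the reference law). [difficulty: L] (why it might fail: no
dynamical content; risks are the statics as typed: a uniform canonical inhomogeneous cluster
expansion with o(1) entropy-per-particle control, and hsExcessFreeEnergy ∈ C¹ on the band so the
limsup/deriv EOS is the true one.) [Yau1991, OllaVaradhanYau1993, KipnisLandim1999]
(#7 DiluteSelfConsistency, shared stmt-3091, DROPPED 2026-08-16: the re-typed conjunct (p126922)
carries the packing guard ∀ t < T ∀ x ρ_t(x)σ³ < η₀ as a hypothesis, so the dilute self-consistency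
of classical hs-Euler solutions is no longer load-bearing here; it stays on the board for the routes
that still want it.)
#9 HydrodynamicSufficiency (support) — HYDRODYNAMIC SUFFICIENCY OF THE ONE-SPHERE RESPONSE (the
engine's output): along every Euler activity family, for s ≥ δ, the (N+1)-scaled conditional mean of
the far-future tested field given ONE sphere's initial state is, in L²(LG_τ), within κ of an affine
function α(q₀) + β(q₀)·v₀ + γ(q₀)|v₀|² of that sphere's collision invariants, for N ≥ N₀(κ): a
sphere influences the future macrostate in mean only through the mass, momentum and energy it
carries. Weaker than OneSphereInfluence's identification of the response (OneParticleGreenResponse)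
and than AntiMazur's zero excess Drude weight; delivered by RigidityTransfer. [difficulty:
open-problem] [Spohn1991, Duerinckx2021, CIP1994]
#9 FlowBoxDecoupling (support) — FLOW-BOX DECOUPLING of the two-parameter mean map M^N(s,τ) =
E_{LG_τ}[⟨U_N(Φ_s·),χ⟩] (card transient-covariance-identity crux 1 in regression-projected,
means-only, derivative-free form): for s ≥ δ, |M^N(s+h,τ) − M^N(s,τ+h)| ≤ κh for small h and N ≥
N₀(h) — by the score identities its content is Cov_{LG_τ}(−(∂_τ+L)log LG_τ, Y_s) → 0, Yau's
functional paired with the FUTURE under the INITIAL law. [difficulty: open-problem] [Yau1991,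
OllaVaradhanYau1993, EvansMorriss2008, Sasa2014, Gaspard2022]
#9 MeanMapRegularity (support) — SHORT-TIME REGULARITY OF THE MEAN MAP (the initial layer is
harmless in mean): along every Euler activity family the mean fields satisfy |M^N(s,τ) − M^N(0,τ)| ≤
C s + e_N with e_N → 0 (bounded mean kinetic flux by energy; mean collisional transfer ≤ C s +
O(N^{-1/3}) by the entropy inequality against the invariant law and collision-count moments).
[difficulty: M] [Spohn1991, GST2013, CIP1994]
#9 EulerProfileFamily (support) — EULER ACTIVITY FAMILY (statics + PDE): along every packing-guarded
admissible classical solution there is an activity family a_τ with a_0 = a₀ (canonical laws are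
invariant under a ↦ c·a), continuous, positive, locally Lipschitz in τ, whose local Gibbs laws have
time-0 mean fields converging to the Euler fields at τ (inverse activity–density map of the
low-density virial EOS composed with the smooth solution; LLN of means for local Gibbs laws).
[difficulty: M] [Ruelle1969, LebowitzPenrose1964, Spohn1991]
#9 RigidityTransfer (support) — THE ENGINE (renewal + rigidity + absorption; difficulty L, honest):
SlavedContactSynergy → CLTScaleConcentration → RenewalDefect → HydrodynamicSufficiency. Proof plan
(checked on paper at constant profiles): Lipschitz-in-lag from C2; Campbell/Palm renewal identity
across one step of d mean free times (C3 supplies the time shift off equilibrium; Lanford-type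
control for a FRACTION of a mean free time gives the Palm law of the first collision under LG_τ);
tower property; Hoeffding split at OUTGOING contact; symmetrisation
E_flux[(ψ(v)−ψ(v'))(μ(v')+μ(w'))] = ⟨ψ, Lμ⟩; self-adjointness, ker L = invariants, gap
(BarangerMouhot2005), ‖μ₁‖₂ = O(1) by Bessel from C2, absorption of the slaved term for ϵ below the
gap. [difficulty: L] [BarangerMouhot2005, Mouhot2006, CIP1994, Bremaud2020, LastPenrose2017,
EfronStein1981]
#9 SufficiencyToFlowBox (support) — SUFFICIENCY ⇒ FLOW BOX (difficulty L): HydrodynamicSufficiency →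
SlavedContactSynergy → CLTScaleConcentration → RenewalDefect → FlowBoxDecoupling. The exact score
identities (∂_τ M = Cov(profile score, Y), exponential family; ∂_s M = Cov(dynamical score, Y),
Kawasaki/TTCF with the collisional score as a contact-flux integral) and Yau's cancellation (the
hydro projection of the dynamical score is the Euler profile score up to o(1) statics, incl. the
virial pressure) make the flow-box defect Cov(⊥-score(0), Y_s); its kinetic part is ⟨Burnett, μ₁⟩ →
0 by sufficiency, its collisional part a flux pairing of the transfer weight with μ₂, reduced by the
same Hoeffding split and slaving. [difficulty: L] [Yau1991, OllaVaradhanYau1993, EvansMorriss2008,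
Sasa2014, Spohn1991]
#9 MeansByCharacteristics (support) — MEANS BY CHARACTERISTICS (calculus + bookkeeping, provable now
modulo its inputs): FlowBoxDecoupling → MeanMapRegularity → EulerProfileFamily →
MeanHydroLimitInBand, by the exact antidiagonal telescope M(t,0) − M(0,t) = Σ_k [M((k+1)h, t−(k+1)h)
− M(kh, t−kh)] (each summand a flow-box defect ≤ κh once kh ≥ δ; the layer kh < δ telescopes to
M(δ,t−δ) − M(0,t), paid by MeanMapRegularity and continuity of the Euler fields), η := min, σ₀ :=
min. [difficulty: provable-now] [Spohn1991]

TWO-LAYER PLAN. Foreseen glued splits (none filed now): SlavedContactSynergy ⇐ EpisodeTermination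
(prompt re-encounter episodes of an outgoing contact pair
terminate within K mean free times with probability 1 − c/K under the flux-LG law, the d = 3 ring
integral) → SeparatedPairAdditivity (synergy
of K-separated pairs is o(1/N): Bessel from C2 + bounded density of the pushed-forward pair law) →
SlavedContactSynergy; RenewalDefect ⇐
constant-profile identity (stationarity, provable now) → first-order-in-gradients form →
RenewalDefect; RigidityTransfer ⇐ equilibrium rigidity
theorem (C1_eq ⇒ equilibrium ⊥-decorrelation; the crisp first rung) → non-equilibrium lift.

KILL CRITERIA. Refutation of SlavedContactSynergy at CONSTANT profiles (an unslaved O(1)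
outgoing-contact synergy in the equilibrium gas at small packing)
closes the route outright (the engine has nothing to turn); refutation of CLTScaleConcentration
(super-CLT fluctuations pre-shock) forces a
pivot to variance-free docking (bounded observables, L¹); refutation of RenewalDefect forces the
equilibrium-only version (a support theorem,
not a route); DiluteSelfConsistency / DenseExcursion no longer bear on this route: the conjunct IS
packing-guarded since the
2026-08-16 re-type (p126922) and `closes` consumes its guard (η₀ := min of the two item bands).
Proved elsewhere and mooting: OneSphereInfluence.ScoreLinearResponse or
AthermalClockWard.OneDirectionResponse give the means directly.

NOT DECOMPOSED YET. The Palm/Campbell calculus for the collision point process of a tagged sphere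
under local Gibbs laws (collision flux measure, finiteness of
moments of window counts — vocabulary exists in Literature/…/CollisionWindowCompensator), the
Bessel/Efron–Stein inequality for the canonical
hard-core law (cf. OneSphereInfluence.HardCorePoincare, the reverse direction), the contact-flux
form of the collisional score and the virial
identification of its hydro projection (statics), and the Lanford short-window control of the first
collision are all inside the supports and
will become layer-2 children only when a crux closes.

CHEAPEST FALSIFIER. (i) Paper, an afternoon: the symmetrisation identity
E_flux[(ψ(v)−ψ(v'))(μ(v')+μ(w'))] = ⟨ψ, Lμ⟩_{L²(M)} and its two degenerate cases
(λ = 0 ideal gas: identity void; 1-D swap rule: L ≡ 0) — done by the planner (NOTES.md), consistent.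
(ii) MD, a week: event-driven hard spheres at
packing 0.05–0.2, N = 10⁴–10⁵, sinusoidal local-Gibbs start; estimate the one-sphere response μ₁(v₀)
= N·(E[⟨m_N(s),χ⟩ | v₀] − mean) by binning
initial velocities, and its ℓ = 2 / ℓ = 3 harmonic content vs the affine fit at s = 2–20 mean free
times: a plateau of relative size not
decreasing with packing kills HydrodynamicSufficiency and hence the line. (iii) Lookup: any theorem
exhibiting a local two-body conserved
quantity of the hard-sphere gas (none expected; Simanyi2013 excludes exact ones at finite N).

NUMBERS. Step r = d(N+1)^{-1/3} ≍ d mean free times (collision rate per sphere ≍ σ²(N+1)^{1/3});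
renewal rate of convergence Kn·δ^{-1/2}σ^{-2} in the
equilibrium identity; ring/re-encounter tail ∫_K^∞ dτ/τ² = 1/K in d = 3 (Cohen 1967 (13)–(14),
transcribed in NoDensityExpansion.lean) vs log K in
d = 2; linearised hard-sphere gap explicit (BarangerMouhot2005); absorption needs ϵ·‖L⁻¹‖ < 1.

DEFINITION REQUESTS. None for the typed items (conditional expectations are Mathlib's
`MeasureTheory.condExp` over comap σ-algebras; contact thickening, flux weight,
outgoing twin `collidePair`, separation `Geometry.sepVec` are tree vocabulary). Wanted later (layer
2): the collision Palm measure of a tagged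
sphere under a local Gibbs law as a named Literature object (topic
Literature/MathematicalPhysics/KineticTheory, next to CollisionWindowCompensator).

Novelty: Searches (2026-08-16): grep census of all 136 Theses and 146 Ideas of the sub for renewal / Palm /
Campbell / "kernel of L" / linearised Boltzmann /
synergy / Hoeffding / response function / Luttinger / TTCF / flow-box (hits read: Palm and Campbell
only inside InformationPercolationEngine's hazard
compensator and AnosovDice; "Ker L" only for the KOOPMAN generator in AntiMazur / Mourre /
Dispersal; TTCF in athermal-clock-ward-identity,
transient-covariance-identity, drude-weight-duhamel; no renewal-rigidity anywhere); lit search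
--hybrid --source local ×6 ("kinetic theory of time
correlation functions hard sphere Enskog", "hydrodynamic projection conserved charges Euler scale",
"Palm measure Campbell formula collisions
billiard", "linearized Boltzmann operator kernel collision invariants spectral gap", …: Soto2016,
CIP1994, SaintRaymond2009, March–Tosi 1976,
Bremaud2020, LastPenrose2017 pages); lit read Spohn1991 pp. 87–95 (§7.1 (7.13)–(7.19), §7.2
(7.44)–(7.58)); lit cite doi:10.1103/PhysRev.188.487;
remote cascade (OpenAlex/S2) rate-limited and shared searchd down during the session (recorded in
NOTES.md); ledger negatives (15, none touched).
Nearest prior art found: on the board — OneSphereInfluence (same object μ₁, IDENTIFIES it along a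
profile homotopy: ScoreLinearResponse),
AthermalClockWard (identifies one scaling response; shares the MeanClosure dock), card
transient-covariance-identity (variant; the Duhamel/TTCF
reduction that this route uses as its dock, never routed  [refs: 10.1103/PhysRev.188.487, doi:10.1103/PhysRev.188.487, Soto2016, CIP1994, SaintRaymond2009, Bremaud2020, LastPenrose2017, Spohn1991, Doyon2022, LebowitzPercusSykes1969, BarangerMouhot2005]

Barriers (technique_class: palm-renewal collision-invariant-rigidity additivity): - technique_class: palm-renewal collision-invariant-rigidity additivity
- Literature.Barriers.AtomisticToContinuum.BoltzmannHypothesisBarrier: no stationary state of any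
infinite dynamics is classified and no ergodic theorem is invoked; the five-dimensionality comes
from ker L of the one-particle linearised operator, and the barrier's own kernel (ideal gas:
arbitrary h(v) stationary) is exactly where the renewal identity is void (λ = 0) — the line uses
collisions where the barrier says one must. Honest residue: charge completeness re-enters in soft L²
form as SlavedContactSynergy (a hidden two-body charge = unslaved synergy); the bet is that pair
additivity at outgoing contact is provable where classification is not.
- Literature.Barriers.AtomisticToContinuum.HighMomentumCutoffBarrier: evaded structurally — every
cubic/quartic velocity weight is integrated against an explicit local Gibbs law (Gaussian tails) or
enters through L²(LG) norms; the evolved law is only paired with the conserved fields; MeanClosure's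
entropy step uses log LG linear in the fields, no cutoff.
- Literature.Barriers.AtomisticToContinuum.NoDensityExpansionBarrier: not met — nothing is expanded
in density or in collision histories; its physics (rings) is the slaving constant, a convergent
∫dτ/τ² in d = 3 used only over ONE renewal step, never summed over N^{1/3} steps.
- Literature.Barriers.AtomisticToContinuum.DiluteRegimeBarrier: not met — σ fixed, no Boltzmann–Grad
limit; the EOS enters through the sta

History (route lifecycle, newest last):
- 2026-08-16T23:27:23Z · rev 2: restated Assembly (stmt-AtomisticToContinuum-15335) — route-repair (statement-revised, p126922): closes re-elaborated against the packing-guarded _root_.HydrodynamicLimit — eta0 := min of the MeanHydroLimitInBand / (planner-rrepair-AtomisticToContinuum-ResponseR-fd758f95-0)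
- 2026-08-16T23:27:23Z · rev 2: dropped DiluteSelfConsistency — route-repair (statement-revised, p126922): closes re-elaborated against the packing-guarded _root_.HydrodynamicLimit — eta0 := min of the MeanHydroLimitInBand / (planner-rrepair-AtomisticToContinuum-ResponseR-fd758f95-0)
- 2026-08-23T09:38:06Z · DORMANT — reconciler: no traction for 6 d (last activity statement-grounded at 2026-08-17T07:59:05Z); parked, not closed — `ledger route dormant route-AtomisticToContinuu (operator:999:2361811)

sub-problem: HydrodynamicLimit · status: dormant · opened planner-plan-novel-AtomisticToContinuum-Hydrody-41806d41-0 2026-08-16T14:29:56Z · rev 3 · ledger route-AtomisticToContinuum-ResponseRigidity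
GENERATED by the gate from the ledger (D-0016/17). Provers cite these decls: `theorem foo : Summit.AtomisticToContinuum.HydrodynamicLimit.Theses.ResponseRigidity.<Decl> := …` in Summits/AtomisticToContinuum/HydrodynamicLimit/Theorems/<Name>.lean.
-/

namespace Summit.AtomisticToContinuum.HydrodynamicLimit.Theses.ResponseRigidity

open scoped BigOperators Topology Manifold Classical MeasureTheory ProbabilityTheory Matrix InnerProductSpace ComplexConjugate ContinuousMap
open Filter Set Function TopologicalSpace MeasureTheory

attribute [summit_statement] _root_.HydrodynamicLimit

/-- item stmt-AtomisticToContinuum-11927 · target · rank 0 · open · by planner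
why it might fail: it is the guarded conjunct restricted to means (⇔ conjunct given MeanClosure): fails iff local equilibrium fails to propagate in mean at fixed small σ pre-shock (Spohn1991 I.3; OllaVaradhanYau1993 need noise).
sources: Spohn1991, OllaVaradhanYau1993
[target] MEAN hydrodynamic limit in the dilute band (typed waypoint X_mean): ∃ η > 0, ∀ continuous
positive profiles ∃ σ₀ ∀ σ ∈ (0,σ₀), for every classical hs-Euler solution on [0,T) with packing
ρ_t(x)σ³ < η on [0,T), every flow family with the t = 0 LLN, every t < T and every smooth χ, the
EXPECTATIONS under localGibbsLaw of the empirical density / momentum (componentwise) / energy fields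
at time t converge to ∫χρ_t, ∫χρ_t u_{t,j}, ∫χE_t. Delivered by WardToMeans from R, W, C, S;
MeanClosure and DiluteSelfConsistency lift it to the conjunct inside `closes`. -/
@[route_item "route-AtomisticToContinuum-ResponseRigidity"]
def MeanHydroLimitInBand : Prop :=
  ∃ η : ℝ, 0 < η ∧ ∀ (a₀ θ₀ : Literature.MathematicalPhysics.KineticTheory.T3 → ℝ) (u₀ : Literature.MathematicalPhysics.KineticTheory.T3 → Literature.MathematicalPhysics.KineticTheory.V3), Continuous a₀ → Continuous θ₀ → Continuous u₀ → (∀ x, 0 < a₀ x) → (∀ x, 0 < θ₀ x) → ∃ σ₀ : ℝ, 0 < σ₀ ∧ ∀ σ : ℝ, 0 < σ → σ < σ₀ → ∀ (T : ℝ) (ρ θ : ℝ → Literature.MathematicalPhysics.KineticTheory.T3 → ℝ) (u : ℝ → Literature.MathematicalPhysics.KineticTheory.T3 → Literature.MathematicalPhysics.KineticTheory.V3), Literature.MathematicalPhysics.KineticTheory.IsHardSphereEulerSolution σ T ρ u θ → (∀ t ∈ Set.Ico 0 T, ∀ x, ρ t x * σ ^ 3 < η) → ∀ Φ : (N : ℕ)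 → Literature.Analysis.FluidPDE.HardSphereFlow (Literature.Analysis.FluidPDE.Torus.geometry (Fin 3)) (Literature.MathematicalPhysics.KineticTheory.hsDiameter σ N) (N + 1), Literature.MathematicalPhysics.KineticTheory.TendstoHydroFieldsAt (fun N => Literature.MathematicalPhysics.KineticTheory.localGibbsLaw σ a₀ u₀ θ₀ N (Φ N)) Φ ρ u θ 0 → ∀ t ∈ Set.Ico 0 T, ∀ χ : Literature.MathematicalPhysics.KineticTheory.T3 → ℝ, Literature.Analysis.FunctionSpaces.Torus.IsSmooth χ → Filter.Tendsto (fun N : ℕ => ∫ z, Literature.MathematicalPhysics.KineticTheory.empiricalDensityField ((Φ N).flow t z) χ ∂(Literature.MathematicalPhysics.KineticTheory.localGibbsLaw σ a₀ u₀ θ₀ N (Φ N))) Filter.atTop (nhds (∫ x, χ x * ρ t x)) ∧ (∀ j : Fin 3, Filter.Tendsto (fun N : ℕ => ∫ z, Literature.MathematicalPhysics.KineticTheory.empiricalMomentumField ((Φ N).flow t z) χ j ∂(Literature.MathematicalPhysics.KineticTheory.localGibbsLaw σ a₀ u₀ θ₀ N (Φ N))) Filter.atTop (nhds (∫ x, χ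 x * ρ t x * u t x j))) ∧ Filter.Tendsto (fun N : ℕ => ∫ z, Literature.MathematicalPhysics.KineticTheory.empiricalEnergyField ((Φ N).flow t z) χ ∂(Literature.MathematicalPhysics.KineticTheory.localGibbsLaw σ a₀ u₀ θ₀ N (Φ N))) Filter.atTop (nhds (∫ x, χ x * Literature.MathematicalPhysics.KineticTheory.totalEnergyDensity (ρ t x) (u t x) (θ t x)))

/-- item stmt-AtomisticToContinuum-15324 · crux · rank 2 · open · by planner
why it might fail: a hidden two-body (quasi-)conserved quantity, or O(1) cascade-merging synergy of contact pairs beyond prompt re-encounters, gives unslaved synergy ≍ 1 at fixed σ; slaving constant may be ≍ φ^a but not → 0 inside the admissible band; open even at constant profiles.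
sources: Spohn1991, CIP1994, BarangerMouhot2005, EfronStein1981, Duerinckx2021, LebowitzPercusSykes1969
[crux] SLAVED CONTACT SYNERGY (the new load-bearing statement). Along every Euler activity family,
for every ⊥-test function ψ(q,v) = φ(q)·p((v − u_τ(q))/√θ_τ(q)) with p ⊥ {1, c, |c|²} under the
standard Gaussian (unit L²(gauss) ball, quartic growth), every δ > 0 and s ∈ [δ, t], τ with s + τ ≤
t: the pairing, under the thickened incoming-contact flux measure of LG_τ (normalised by its mass
Z), of the collision difference ψ(v₀) − ψ(v₀') with the OUTGOING pair synergy S∘collidePair, S = μ₂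
− μ₁ − μ₁' ((N+1)-scaled conditional means of the far-future field Y = ⟨U_N(Φ_s·),χ⟩ given (z₀,z₁),
z₀, z₁), is bounded by ϵ·dist_{L²(LG_τ)}(μ₁, {α(q₀) + β(q₀)·v₀ + γ(q₀)|v₀|²}) + κ' for N ≥
N₀(thickening), for EVERY ϵ > 0 once the packing band η(ϵ) is small: synergy at outgoing contact is
carried only by prompt re-encounter episodes, through which conserved content passes additively, so
only the ⊥-part of the response is visible to ⊥ collision differences, with weight = re-encounter
probability → 0 with the packing. [difficulty: open-problem] -/
@[route_item "route-AtomisticToContinuum-ResponseRigidity", crux]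
def SlavedContactSynergy : Prop :=
  open Literature.MathematicalPhysics.KineticTheory Literature.Analysis.FluidPDE in ∀ ϵ : ℝ, 0 < ϵ → ∃ η : ℝ, 0 < η ∧ ∀ (a₀ θ₀ : T3 → ℝ) (u₀ : T3 → V3), Continuous a₀ → Continuous θ₀ → Continuous u₀ → (∀ x, 0 < a₀ x) → (∀ x, 0 < θ₀ x) → ∃ σ₀ : ℝ, 0 < σ₀ ∧ ∀ σ : ℝ, 0 < σ → σ < σ₀ → ∀ (T : ℝ) (ρ θ : ℝ → T3 → ℝ) (u : ℝ → T3 → V3), IsHardSphereEulerSolution σ T ρ u θ → (∀ t ∈ Set.Ico 0 T, ∀ x, ρ t x * σ ^ 3 < η) → ∀ Φ : (N : ℕ) → HardSphereFlow (Torus.geometry (Fin 3)) (hsDiameter σ N) (N + 1), TendstoHydroFieldsAt (fun N => localGibbsLaw σ a₀ u₀ θ₀ N (Φ N)) Φ ρ u θ 0 → ∀ a : ℝ → T3 → ℝ, a 0 = a₀ → (∀ τ ∈ Set.Ico 0 T, Continuous (a τ) ∧ ∀ x, 0 < a τ x) → (∀ τ ∈ Set.Ico 0 T, ∀ χ : T3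 → ℝ, Literature.Analysis.FunctionSpaces.Torus.IsSmooth χ → Tendsto (fun N : ℕ => ∫ z, empiricalDensityField z χ ∂(localGibbsLaw σ (a τ) (u τ) (θ τ) N (Φ N))) atTop (𝓝 (∫ x, χ x * ρ τ x)) ∧ (∀ j : Fin 3, Tendsto (fun N : ℕ => ∫ z, empiricalMomentumField z χ j ∂(localGibbsLaw σ (a τ) (u τ) (θ τ) N (Φ N))) atTop (𝓝 (∫ x, χ x * ρ τ x * u τ x j))) ∧ Tendsto (fun N : ℕ => ∫ z, empiricalEnergyField z χ ∂(localGibbsLaw σ (a τ) (u τ) (θ τ) N (Φ N))) atTop (𝓝 (∫ x, χ x * totalEnergyDensity (ρ τ x) (u τ x) (θ τ x)))) → ∀ t ∈ Set.Ico 0 T, ∀ χ : T3 → ℝ, Literature.Analysis.FunctionSpaces.Torus.IsSmooth χ → ∀ φw : T3 → ℝ, Continuous φw → (∀ x, |φw x| ≤ 1) → ∀ p : V3 → ℝ, Continuous p → (∃ Cp : ℝ, ∀ c, |p c| ≤ Cp * (1 + ‖c‖ ^ 2) ^ 2) → (∫ c, p c * Real.exp (-‖c‖ ^ 2 / 2)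 = 0 ∧ (∀ i : Fin 3, ∫ c, p c * c i * Real.exp (-‖c‖ ^ 2 / 2) = 0) ∧ ∫ c, p c * ‖c‖ ^ 2 * Real.exp (-‖c‖ ^ 2 / 2) = 0) → (∫ c, p c ^ 2 * Real.exp (-‖c‖ ^ 2 / 2) ≤ 1) → ∀ δ : ℝ, 0 < δ → ∀ κ' : ℝ, 0 < κ' → ∃ η'₀ : ℝ, 0 < η'₀ ∧ ∀ η' : ℝ, 0 < η' → η' < η'₀ → ∃ N₀ : ℕ, ∀ N : ℕ, N₀ ≤ N → ∀ s τ : ℝ, δ ≤ s → 0 ≤ τ → s + τ ≤ t → let G3 := Torus.geometry (Fin 3); let P : Measure (Config (N + 1) (Fin 3) T3) := localGibbsLaw σ (a τ) (u τ) (θ τ) N (Φ N); let m0 : MeasurableSpace (Config (N + 1) (Fin 3) T3) := MeasurableSpace.comap (fun z : Config (N + 1) (Fin 3) T3 => z 0) inferInstance; let m1 : MeasurableSpace (Config (N + 1) (Fin 3) T3) := MeasurableSpace.comap (fun z : Config (N + 1) (Fin 3) T3 => z 1) inferInstance; let m01 : MeasurableSpace (Config (N + 1) (Fin 3) T3) :=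 MeasurableSpace.comap (fun z : Config (N + 1) (Fin 3) T3 => (z 0, z 1)) inferInstance; let ψ : Config (N + 1) (Fin 3) T3 → ℝ := fun z => φw (z 0).1 * p ((Real.sqrt (θ τ (z 0).1))⁻¹ • ((z 0).2 - u τ (z 0).1)); let ψout : Config (N + 1) (Fin 3) T3 → ℝ := fun z => φw (z 0).1 * p ((Real.sqrt (θ τ (z 0).1))⁻¹ • (((collidePair G3 0 1 z) 0).2 - u τ (z 0).1)); let wt : Config (N + 1) (Fin 3) T3 → ℝ := fun z => |⟪G3.sepVec (z 0).1 (z 1).1, (z 0).2 - (z 1).2⟫_ℝ| / ‖G3.sepVec (z 0).1 (z 1).1‖; let A : Set (Config (N + 1) (Fin 3) T3) := {z | ‖G3.sepVec (z 0).1 (z 1).1‖ < hsDiameter σ N * (1 + η') ∧ IsIncoming G3 z 0 1}; let Zn : ℝ := ∫ z, A.indicator wt z ∂P; ∀ F : Config (N + 1) (Fin 3) T3 → ℝ, (F = (fun z => empiricalDensityField ((Φ N).flow s z) χ) ∨ (∃ j : Fin 3, F = fun z => empiricalMomentumField ((Φ N).flow s z) χ j) ∨ F = fun z => empiricalEnergyField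 ((Φ N).flow s z) χ) → ∀ (α γ : T3 → ℝ) (β : T3 → V3), Continuous α → Continuous β → Continuous γ → let μ1 : Config (N + 1) (Fin 3) T3 → ℝ := fun z => ((N : ℝ) + 1) * (MeasureTheory.condExp m0 P F z - ∫ w, F w ∂P); let μ1' : Config (N + 1) (Fin 3) T3 → ℝ := fun z => ((N : ℝ) + 1) * (MeasureTheory.condExp m1 P F z - ∫ w, F w ∂P); let μ2 : Config (N + 1) (Fin 3) T3 → ℝ := fun z => ((N : ℝ) + 1) * (MeasureTheory.condExp m01 P F z - ∫ w, F w ∂P); let S : Config (N + 1) (Fin 3) T3 → ℝ := fun z => μ2 z - μ1 z - μ1' z; let r : Config (N + 1) (Fin 3) T3 → ℝ := fun z => μ1 z - (α (z 0).1 + ⟪β (z 0).1, (z 0).2⟫_ℝ + γ (z 0).1 * ‖(z 0).2‖ ^ 2); Integrable (fun z => r z ^ 2) P → |Zn⁻¹ * ∫ z, A.indicator (fun z => wt z * (ψ z - ψout z) * S (collidePair G3 0 1 z)) z ∂P| ≤ ϵ * Real.sqrt (∫ z, r z ^ 2 ∂P) + κ'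

/-- item stmt-AtomisticToContinuum-15325 · crux · rank 3 · open · by planner
why it might fail: super-CLT fluctuations of conserved fields at fixed density pre-shock (an instability amplifying thermal seeds before t, cf. the zero-horizon/Ehrenfest cards) would give Var ≫ 1/N at some s ≥ δ; uniformity down to N small forces a large C only.
sources: Spohn1991, OllaVaradhanYau1993, Duerinckx2021
[crux] CLT-SCALE CONCENTRATION WITHOUT IDENTIFICATION. Along every Euler activity family and for
every smooth χ there is C with Var_{LG_τ}(⟨U_N(Φ_s·),χ⟩) ≤ C/(N+1) (density, momentum components,
energy; square integrable) for all N and all 0 ≤ s, τ with s + τ ≤ t: the fields concentrate at the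
central-limit scale around their (unidentified) means. At s = 0 it is the static local-Gibbs CLT
bound; at constant profiles it is free by stationarity. It supplies ‖μ₁‖_{L²} = O(1) (Bessel) and
the Lipschitz-in-lag step of the renewal. [difficulty: L] -/
@[route_item "route-AtomisticToContinuum-ResponseRigidity", crux]
def CLTScaleConcentration : Prop :=
  open Literature.MathematicalPhysics.KineticTheory Literature.Analysis.FluidPDE in ∃ η : ℝ, 0 < η ∧ ∀ (a₀ θ₀ : T3 → ℝ) (u₀ : T3 → V3), Continuous a₀ → Continuous θ₀ → Continuous u₀ → (∀ x, 0 < a₀ x) → (∀ x, 0 < θ₀ x) → ∃ σ₀ : ℝ, 0 < σ₀ ∧ ∀ σ : ℝ, 0 < σ → σ < σ₀ → ∀ (T : ℝ) (ρ θ : ℝ → T3 → ℝ) (u : ℝ → T3 → V3), IsHardSphereEulerSolution σ T ρ u θ → (∀ t ∈ Set.Ico 0 T, ∀ x, ρ t x * σ ^ 3 < η) → ∀ Φ : (N : ℕ) → HardSphereFlow (Torus.geometry (Fin 3)) (hsDiameter σ N) (N + 1), TendstoHydroFieldsAt (fun N => localGibbsLaw σ a₀ u₀ θ₀ N (Φ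 N)) Φ ρ u θ 0 → ∀ a : ℝ → T3 → ℝ, a 0 = a₀ → (∀ τ ∈ Set.Ico 0 T, Continuous (a τ) ∧ ∀ x, 0 < a τ x) → (∀ τ ∈ Set.Ico 0 T, ∀ χ : T3 → ℝ, Literature.Analysis.FunctionSpaces.Torus.IsSmooth χ → Tendsto (fun N : ℕ => ∫ z, empiricalDensityField z χ ∂(localGibbsLaw σ (a τ) (u τ) (θ τ) N (Φ N))) atTop (𝓝 (∫ x, χ x * ρ τ x)) ∧ (∀ j : Fin 3, Tendsto (fun N : ℕ => ∫ z, empiricalMomentumField z χ j ∂(localGibbsLaw σ (a τ) (u τ) (θ τ) N (Φ N))) atTop (𝓝 (∫ x, χ x * ρ τ x * u τ x j))) ∧ Tendsto (fun N : ℕ => ∫ z, empiricalEnergyField z χ ∂(localGibbsLaw σ (a τ) (u τ) (θ τ) N (Φ N))) atTop (𝓝 (∫ x, χ x * totalEnergyDensity (ρ τ x) (u τ x) (θ τ x)))) → ∀ t ∈ Set.Ico 0 T, ∀ χ : T3 → ℝ, Literature.Analysis.FunctionSpaces.Torus.IsSmooth χ → ∃ C : ℝ, ∀ N : ℕ, ∀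 s τ : ℝ, 0 ≤ s → 0 ≤ τ → s + τ ≤ t → let P : Measure (Config (N + 1) (Fin 3) T3) := localGibbsLaw σ (a τ) (u τ) (θ τ) N (Φ N); ∀ F : Config (N + 1) (Fin 3) T3 → ℝ, (F = (fun z => empiricalDensityField ((Φ N).flow s z) χ) ∨ (∃ j : Fin 3, F = fun z => empiricalMomentumField ((Φ N).flow s z) χ j) ∨ F = fun z => empiricalEnergyField ((Φ N).flow s z) χ) → Integrable (fun z => (F z - ∫ w, F w ∂P) ^ 2) P ∧ ∫ z, (F z - ∫ w, F w ∂P) ^ 2 ∂P ≤ C / ((N : ℝ) + 1)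

/-- item stmt-AtomisticToContinuum-15326 · crux · rank 4 · open · by planner
why it might fail: Φ_r#LG_τ and LG_{τ+r} are far apart as measures (relative entropy ≍ d²N^{1/3}); the claim needs the ψ(z₀)·future-field observable to see only the hydrodynamic part of that distortion — a three-point (⊥, one-sphere ⊥, future) additivity that could fail at O(d).
sources: Yau1991, OllaVaradhanYau1993, Sasa2014, Gaspard2022
[crux] ONE-SPHERE RENEWAL DEFECT (the non-stationarity price; an identity at constant profiles). For
ψ(q,v) = φ(q)p(c) of quartic growth, δ ≤ s, s + τ ≤ t and the step r = d(N+1)^{-1/3} (d mean free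
times up to constants): (N+1)·|E_{LG_τ}[ψ_τ(z₀(r))·(Y_s − EY_s)] −
E_{LG_{τ+r}}[ψ_{τ+r}(z₀(0))·(Y_{s−r} − EY_{s−r})]| ≤ κ'·d for small d and N ≥ N₀(d): reading the
⊥-weight on sphere 0 after the step under LG_τ is the same, to o(d), as reading it at time 0 under
the Euler-advanced law with the horizon shortened — the time-shift that stationarity gives for free
at equilibrium. [difficulty: open-problem] -/
@[route_item "route-AtomisticToContinuum-ResponseRigidity", crux]
def RenewalDefect : Prop :=
  open Literature.MathematicalPhysics.KineticTheory Literature.Analysis.FluidPDE in ∃ η : ℝ, 0 < η ∧ ∀ (a₀ θ₀ : T3 → ℝ) (u₀ : T3 → V3), Continuous a₀ → Continuous θ₀ → Continuous u₀ → (∀ x, 0 < a₀ x) → (∀ x, 0 < θ₀ x) → ∃ σ₀ : ℝ, 0 < σ₀ ∧ ∀ σ : ℝ, 0 < σ → σ < σ₀ → ∀ (T : ℝ) (ρ θ : ℝ → T3 → ℝ) (u : ℝ → T3 → V3), IsHardSphereEulerSolution σ T ρ u θ → (∀ t ∈ Set.Ico 0 T, ∀ x, ρ t x * σ ^ 3 <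 η) → ∀ Φ : (N : ℕ) → HardSphereFlow (Torus.geometry (Fin 3)) (hsDiameter σ N) (N + 1), TendstoHydroFieldsAt (fun N => localGibbsLaw σ a₀ u₀ θ₀ N (Φ N)) Φ ρ u θ 0 → ∀ a : ℝ → T3 → ℝ, a 0 = a₀ → (∀ τ ∈ Set.Ico 0 T, Continuous (a τ) ∧ ∀ x, 0 < a τ x) → (∀ τ ∈ Set.Ico 0 T, ∀ χ : T3 → ℝ, Literature.Analysis.FunctionSpaces.Torus.IsSmooth χ → Tendsto (fun N : ℕ => ∫ z, empiricalDensityField z χ ∂(localGibbsLaw σ (a τ) (u τ) (θ τ) N (Φ N))) atTop (𝓝 (∫ x, χ x * ρ τ x)) ∧ (∀ j : Fin 3, Tendsto (fun N : ℕ => ∫ z, empiricalMomentumField z χ j ∂(localGibbsLaw σ (a τ) (u τ) (θ τ) N (Φ N))) atTop (𝓝 (∫ x, χ x * ρ τ x * u τ x j))) ∧ Tendsto (fun N : ℕ => ∫ z, empiricalEnergyField z χ ∂(localGibbsLaw σ (a τ) (u τ) (θ τ) N (Φ N))) atTop (𝓝 (∫ x, χ x * totalEnergyDensity (ρ τ x)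 (u τ x) (θ τ x)))) → ∀ t ∈ Set.Ico 0 T, ∀ χ : T3 → ℝ, Literature.Analysis.FunctionSpaces.Torus.IsSmooth χ → ∀ φw : T3 → ℝ, Continuous φw → (∀ x, |φw x| ≤ 1) → ∀ p : V3 → ℝ, Continuous p → (∃ Cp : ℝ, ∀ c, |p c| ≤ Cp * (1 + ‖c‖ ^ 2) ^ 2) → ∀ δ : ℝ, 0 < δ → ∀ κ' : ℝ, 0 < κ' → ∃ d₀ : ℝ, 0 < d₀ ∧ ∀ d : ℝ, 0 < d → d < d₀ → ∃ N₀ : ℕ, ∀ N : ℕ, N₀ ≤ N → ∀ s τ : ℝ, δ ≤ s → 0 ≤ τ → s + τ ≤ t → let r : ℝ := d * ((N : ℝ) + 1) ^ (-(1 / 3 : ℝ)); let P : Measure (Config (N + 1) (Fin 3) T3) := localGibbsLaw σ (a τ) (u τ) (θ τ) N (Φ N); let P' : Measure (Config (N + 1) (Fin 3) T3) := localGibbsLaw σ (a (τ + r)) (u (τ + r)) (θ (τ + r)) N (Φ N); let ψ : Config (N + 1) (Fin 3) T3 → ℝ := fun z => φw (z 0).1 * p ((Real.sqrt (θ τ (z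 0).1))⁻¹ • ((z 0).2 - u τ (z 0).1)); let ψ' : Config (N + 1) (Fin 3) T3 → ℝ := fun z => φw (z 0).1 * p ((Real.sqrt (θ (τ + r) (z 0).1))⁻¹ • ((z 0).2 - u (τ + r) (z 0).1)); ∀ F₀ : Config (N + 1) (Fin 3) T3 → ℝ, (F₀ = (fun z => empiricalDensityField z χ) ∨ (∃ j : Fin 3, F₀ = fun z => empiricalMomentumField z χ j) ∨ F₀ = fun z => empiricalEnergyField z χ) → |((N : ℝ) + 1) * ∫ z, ψ ((Φ N).flow r z) * (F₀ ((Φ N).flow s z) - ∫ w, F₀ ((Φ N).flow s w) ∂P) ∂P - ((N : ℝ) + 1) * ∫ z, ψ' z * (F₀ ((Φ N).flow (s - r) z) - ∫ w, F₀ ((Φ N).flow (s - r) w) ∂P') ∂P'| ≤ κ' * d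

/-- item stmt-AtomisticToContinuum-15327 · crux · rank 5 · open · by planner
why it might fail: fails where its supports do: Palm/Campbell calculus of the tagged collision process under NON-invariant local Gibbs laws, the contact-flux form of the collisional score with the virial identification of its hydro projection, or the canonical cluster-expansion statics.
sources: Yau1991, OllaVaradhanYau1993, BarangerMouhot2005, Bremaud2020, LastPenrose2017, Spohn1991
[crux] ENGINE REDUCTION (one crux BY RULE — only cruxes may feed `closes`; its proof is the
composition of the typed supports RigidityTransfer, SufficiencyToFlowBox and MeansByCharacteristics
with the statics/regularity supports MeanMapRegularity and EulerProfileFamily proved as lemmas):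
SlavedContactSynergy → CLTScaleConcentration → RenewalDefect → MeanHydroLimitInBand. Renewal +
rigidity + absorption give hydrodynamic sufficiency of the one-sphere response; the score identities
and Yau's cancellation give the flow-box decoupling; the antidiagonal telescope, paid at the initial
layer by short-time regularity of the mean map along the Euler activity family, gives Euler in the
mean in the dilute band. [deps: SlavedContactSynergy, CLTScaleConcentration, RenewalDefect]
[difficulty: L] -/
@[route_item "route-AtomisticToContinuum-ResponseRigidity", crux]
def EngineReduction : Prop :=
  SlavedContactSynergy → CLTScaleConcentration → RenewalDefect → MeanHydroLimitInBand

/-- item stmt-AtomisticToContinuum-11929 · crux · rank 6 · closed · proved by Summit.AtomisticToContinuum.HydrodynamicLimit.Theorems.RestartPrinciple.AgeDuhamelForgetting.meanClosure_holds @ d2307c2802e2 (prover) · by planner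
why it might fail: no dynamical content; risks are the statics as typed: a uniform canonical inhomogeneous cluster expansion with o(1) entropy-per-particle control, and hsExcessFreeEnergy ∈ C¹ on the band so the limsup/deriv EOS is the true one.
sources: Yau1991, OllaVaradhanYau1993, KipnisLandim1999
[crux] MEAN ⇒ PROBABILITY BY ENTROPY SATURATION (card C2; card entropy-saturation-mean-closure (a);
packing-guarded): ∃ η > 0, ∀ continuous positive profiles ∃ σ₀ ∀ σ ∈ (0,σ₀) ∀ classical hs-Euler
solutions on [0,T) with packing < η, ∀ flow families with the t = 0 LLN, ∀ t < T: IF the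
expectations of the empirical density / momentum (componentwise) / energy fields at time t converge
for every smooth χ to ∫χρ_t, ∫χρ_tu_{t,j}, ∫χE_t, THEN TendstoHydroFieldsAt holds at t. Mechanism:
S(f_t) = S(f_0) (Liouville), log ψ[a,u,θ] is LINEAR in the empirical fields (hard core = common
support, no pair energy), classical hs-Euler conserves ∫ρ s(ρ,θ) ⇒ H(f_t | ψ[a_t,u_t,θ_t])/(N+1) =
[S(ψ_t) − S(ψ_0)]/(N+1) − (linear statistic of the mean-field errors) → 0; then the entropy
inequality against the exponential concentration of the reference local Gibbs law. Static inputs at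
packing < η: canonical inhomogeneous cluster expansion (limits of N⁻¹log Z_N(a), N⁻¹S(ψ)), inverse
activity–density map, C¹ virial EOS (shared items HsEosLowDensity 0768 / LocalGibbsConcentration
0767 in content). [difficulty: L] -/
@[route_item "route-AtomisticToContinuum-ResponseRigidity", crux]
def MeanClosure : Prop :=
  ∃ η : ℝ, 0 < η ∧ ∀ (a₀ θ₀ : Literature.MathematicalPhysics.KineticTheory.T3 → ℝ) (u₀ : Literature.MathematicalPhysics.KineticTheory.T3 → Literature.MathematicalPhysics.KineticTheory.V3), Continuous a₀ → Continuous θ₀ → Continuous u₀ → (∀ x, 0 < a₀ x) → (∀ x, 0 < θ₀ x) → ∃ σ₀ : ℝ, 0 < σ₀ ∧ ∀ σ : ℝ, 0 < σ → σ < σ₀ → ∀ (T : ℝ) (ρ θ : ℝ → Literature.MathematicalPhysics.KineticTheory.T3 → ℝ) (u : ℝ → Literature.MathematicalPhysics.KineticTheory.T3 → Literature.MathematicalPhysics.KineticTheory.V3), Literature.MathematicalPhysics.KineticTheory.IsHardSphereEulerSolution σ T ρ u θ → (∀ t ∈ Set.Ico 0 T, ∀ x, ρ t x * σ ^ 3 <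 η) → ∀ Φ : (N : ℕ) → Literature.Analysis.FluidPDE.HardSphereFlow (Literature.Analysis.FluidPDE.Torus.geometry (Fin 3)) (Literature.MathematicalPhysics.KineticTheory.hsDiameter σ N) (N + 1), Literature.MathematicalPhysics.KineticTheory.TendstoHydroFieldsAt (fun N => Literature.MathematicalPhysics.KineticTheory.localGibbsLaw σ a₀ u₀ θ₀ N (Φ N)) Φ ρ u θ 0 → ∀ t ∈ Set.Ico 0 T, (∀ χ : Literature.MathematicalPhysics.KineticTheory.T3 → ℝ, Literature.Analysis.FunctionSpaces.Torus.IsSmooth χ → Filter.Tendsto (fun N : ℕ => ∫ z, Literature.MathematicalPhysics.KineticTheory.empiricalDensityField ((Φ N).flow t z) χ ∂(Literature.MathematicalPhysics.KineticTheory.localGibbsLaw σ a₀ u₀ θ₀ N (Φ N))) Filter.atTop (nhds (∫ x, χ x * ρ t x)) ∧ (∀ j : Fin 3, Filter.Tendsto (fun N : ℕ => ∫ z, Literature.MathematicalPhysics.KineticTheory.empiricalMomentumField ((Φ N).flow t z) χ j ∂(Literature.MathematicalPhysics.KineticTheory.localGibbsLaw σ a₀ u₀ θ₀ N (Φ N)))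 Filter.atTop (nhds (∫ x, χ x * ρ t x * u t x j))) ∧ Filter.Tendsto (fun N : ℕ => ∫ z, Literature.MathematicalPhysics.KineticTheory.empiricalEnergyField ((Φ N).flow t z) χ ∂(Literature.MathematicalPhysics.KineticTheory.localGibbsLaw σ a₀ u₀ θ₀ N (Φ N))) Filter.atTop (nhds (∫ x, χ x * Literature.MathematicalPhysics.KineticTheory.totalEnergyDensity (ρ t x) (u t x) (θ t x)))) → Literature.MathematicalPhysics.KineticTheory.TendstoHydroFieldsAt (fun N => Literature.MathematicalPhysics.KineticTheory.localGibbsLaw σ a₀ u₀ θ₀ N (Φ N)) Φ ρ u θ t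

/-- item stmt-AtomisticToContinuum-15328 · support · rank 9 · open · by planner
sources: Spohn1991, Duerinckx2021, CIP1994
[support] HYDRODYNAMIC SUFFICIENCY OF THE ONE-SPHERE RESPONSE (the engine's output): along every
Euler activity family, for s ≥ δ, the (N+1)-scaled conditional mean of the far-future tested field
given ONE sphere's initial state is, in L²(LG_τ), within κ of an affine function α(q₀) + β(q₀)·v₀ +
γ(q₀)|v₀|² of that sphere's collision invariants, for N ≥ N₀(κ): a sphere influences the future
macrostate in mean only through the mass, momentum and energy it carries. Weaker than
OneSphereInfluence's identification of the response (OneParticleGreenResponse) and than AntiMazur's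
zero excess Drude weight; delivered by RigidityTransfer. [difficulty: open-problem] -/
@[route_item "route-AtomisticToContinuum-ResponseRigidity"]
def HydrodynamicSufficiency : Prop :=
  open Literature.MathematicalPhysics.KineticTheory Literature.Analysis.FluidPDE in ∃ η : ℝ, 0 < η ∧ ∀ (a₀ θ₀ : T3 → ℝ) (u₀ : T3 → V3), Continuous a₀ → Continuous θ₀ → Continuous u₀ → (∀ x, 0 < a₀ x) → (∀ x, 0 < θ₀ x) → ∃ σ₀ : ℝ, 0 < σ₀ ∧ ∀ σ : ℝ, 0 < σ → σ < σ₀ → ∀ (T : ℝ) (ρ θ : ℝ → T3 → ℝ) (u : ℝ → T3 → V3), IsHardSphereEulerSolution σ T ρ u θ → (∀ t ∈ Set.Ico 0 T, ∀ x, ρ t x * σ ^ 3 < η) → ∀ Φ : (N : ℕ) → HardSphereFlow (Torus.geometry (Fin 3)) (hsDiameter σ N) (N + 1), TendstoHydroFieldsAt (fun N => localGibbsLaw σ a₀ u₀ θ₀ N (Φ N)) Φ ρ u θ 0 → ∀ a : ℝ → T3 → ℝ, a 0 = a₀ → (∀ τ ∈ Set.Ico 0 T, Continuous (a τ) ∧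 ∀ x, 0 < a τ x) → (∀ τ ∈ Set.Ico 0 T, ∀ χ : T3 → ℝ, Literature.Analysis.FunctionSpaces.Torus.IsSmooth χ → Tendsto (fun N : ℕ => ∫ z, empiricalDensityField z χ ∂(localGibbsLaw σ (a τ) (u τ) (θ τ) N (Φ N))) atTop (𝓝 (∫ x, χ x * ρ τ x)) ∧ (∀ j : Fin 3, Tendsto (fun N : ℕ => ∫ z, empiricalMomentumField z χ j ∂(localGibbsLaw σ (a τ) (u τ) (θ τ) N (Φ N))) atTop (𝓝 (∫ x, χ x * ρ τ x * u τ x j))) ∧ Tendsto (fun N : ℕ => ∫ z, empiricalEnergyField z χ ∂(localGibbsLaw σ (a τ) (u τ) (θ τ) N (Φ N))) atTop (𝓝 (∫ x, χ x * totalEnergyDensity (ρ τ x) (u τ x) (θ τ x)))) → ∀ t ∈ Set.Ico 0 T, ∀ χ : T3 → ℝ, Literature.Analysis.FunctionSpaces.Torus.IsSmooth χ → ∀ δ : ℝ, 0 < δ → ∀ κ : ℝ, 0 < κ → ∃ N₀ : ℕ, ∀ N : ℕ, N₀ ≤ N → ∀ s τ : ℝ, δ ≤ s → 0 ≤ τ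 → s + τ ≤ t → let P : Measure (Config (N + 1) (Fin 3) T3) := localGibbsLaw σ (a τ) (u τ) (θ τ) N (Φ N); let m0 : MeasurableSpace (Config (N + 1) (Fin 3) T3) := MeasurableSpace.comap (fun z : Config (N + 1) (Fin 3) T3 => z 0) inferInstance; ∀ F : Config (N + 1) (Fin 3) T3 → ℝ, (F = (fun z => empiricalDensityField ((Φ N).flow s z) χ) ∨ (∃ j : Fin 3, F = fun z => empiricalMomentumField ((Φ N).flow s z) χ j) ∨ F = fun z => empiricalEnergyField ((Φ N).flow s z) χ) → ∃ (α γ : T3 → ℝ) (β : T3 → V3), Continuous α ∧ Continuous β ∧ Continuous γ ∧ let r : Config (N + 1) (Fin 3) T3 → ℝ := fun z => ((N : ℝ) + 1) * (MeasureTheory.condExp m0 P F z - ∫ w, F w ∂P) - (α (z 0).1 + ⟪β (z 0).1, (z 0).2⟫_ℝ + γ (z 0).1 * ‖(z 0).2‖ ^ 2); Integrable (fun z => r z ^ 2) P ∧ ∫ z, r z ^ 2 ∂P ≤ κ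

/-- item stmt-AtomisticToContinuum-15329 · support · rank 9 · open · by planner
sources: Yau1991, OllaVaradhanYau1993, EvansMorriss2008, Sasa2014, Gaspard2022
[support] FLOW-BOX DECOUPLING of the two-parameter mean map M^N(s,τ) = E_{LG_τ}[⟨U_N(Φ_s·),χ⟩] (card
transient-covariance-identity crux 1 in regression-projected, means-only, derivative-free form): for
s ≥ δ, |M^N(s+h,τ) − M^N(s,τ+h)| ≤ κh for small h and N ≥ N₀(h) — by the score identities its
content is Cov_{LG_τ}(−(∂_τ+L)log LG_τ, Y_s) → 0, Yau's functional paired with the FUTURE under the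
INITIAL law. [difficulty: open-problem] -/
@[route_item "route-AtomisticToContinuum-ResponseRigidity"]
def FlowBoxDecoupling : Prop :=
  open Literature.MathematicalPhysics.KineticTheory Literature.Analysis.FluidPDE in ∃ η : ℝ, 0 < η ∧ ∀ (a₀ θ₀ : T3 → ℝ) (u₀ : T3 → V3), Continuous a₀ → Continuous θ₀ → Continuous u₀ → (∀ x, 0 < a₀ x) → (∀ x, 0 < θ₀ x) → ∃ σ₀ : ℝ, 0 < σ₀ ∧ ∀ σ : ℝ, 0 < σ → σ < σ₀ → ∀ (T : ℝ) (ρ θ : ℝ → T3 → ℝ) (u : ℝ → T3 → V3), IsHardSphereEulerSolution σ T ρ u θ → (∀ t ∈ Set.Ico 0 T, ∀ x, ρ t x * σ ^ 3 < η) → ∀ Φ : (N : ℕ) → HardSphereFlow (Torus.geometry (Fin 3)) (hsDiameter σ N) (N + 1), TendstoHydroFieldsAt (fun N => localGibbsLaw σ a₀ u₀ θ₀ N (Φ N)) Φ ρ u θ 0 → ∀ a : ℝ → T3 → ℝ, a 0 = a₀ → (∀ τ ∈ Set.Ico 0 T, Continuous (a τ) ∧ ∀ x, 0 < a τ x) →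 (∀ τ ∈ Set.Ico 0 T, ∀ χ : T3 → ℝ, Literature.Analysis.FunctionSpaces.Torus.IsSmooth χ → Tendsto (fun N : ℕ => ∫ z, empiricalDensityField z χ ∂(localGibbsLaw σ (a τ) (u τ) (θ τ) N (Φ N))) atTop (𝓝 (∫ x, χ x * ρ τ x)) ∧ (∀ j : Fin 3, Tendsto (fun N : ℕ => ∫ z, empiricalMomentumField z χ j ∂(localGibbsLaw σ (a τ) (u τ) (θ τ) N (Φ N))) atTop (𝓝 (∫ x, χ x * ρ τ x * u τ x j))) ∧ Tendsto (fun N : ℕ => ∫ z, empiricalEnergyField z χ ∂(localGibbsLaw σ (a τ) (u τ) (θ τ) N (Φ N))) atTop (𝓝 (∫ x, χ x * totalEnergyDensity (ρ τ x) (u τ x) (θ τ x)))) → ∀ t ∈ Set.Ico 0 T, ∀ χ : T3 → ℝ, Literature.Analysis.FunctionSpaces.Torus.IsSmooth χ → ∀ δ : ℝ, 0 < δ → ∀ κ : ℝ, 0 < κ → ∃ h₀ : ℝ, 0 < h₀ ∧ ∀ h : ℝ, 0 < h → h < h₀ → ∃ N₀ : ℕ, ∀ N : ℕ, N₀ ≤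 N → ∀ s τ : ℝ, δ ≤ s → 0 ≤ τ → s + τ + h ≤ t → let P : Measure (Config (N + 1) (Fin 3) T3) := localGibbsLaw σ (a τ) (u τ) (θ τ) N (Φ N); let P' : Measure (Config (N + 1) (Fin 3) T3) := localGibbsLaw σ (a (τ + h)) (u (τ + h)) (θ (τ + h)) N (Φ N); |(∫ z, empiricalDensityField ((Φ N).flow (s + h) z) χ ∂P) - ∫ z, empiricalDensityField ((Φ N).flow s z) χ ∂P'| ≤ κ * h ∧ (∀ j : Fin 3, |(∫ z, empiricalMomentumField ((Φ N).flow (s + h) z) χ j ∂P) - ∫ z, empiricalMomentumField ((Φ N).flow s z) χ j ∂P'| ≤ κ * h) ∧ |(∫ z, empiricalEnergyField ((Φ N).flow (s + h) z) χ ∂P) - ∫ z, empiricalEnergyField ((Φ N).flow s z) χ ∂P'| ≤ κ * h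

/-- item stmt-AtomisticToContinuum-15330 · support · rank 9 · open · by planner
sources: Spohn1991, GST2013, CIP1994
[support] SHORT-TIME REGULARITY OF THE MEAN MAP (the initial layer is harmless in mean): along every
Euler activity family the mean fields satisfy |M^N(s,τ) − M^N(0,τ)| ≤ C s + e_N with e_N → 0
(bounded mean kinetic flux by energy; mean collisional transfer ≤ C s + O(N^{-1/3}) by the entropy
inequality against the invariant law and collision-count moments). [difficulty: M] -/
@[route_item "route-AtomisticToContinuum-ResponseRigidity"]
def MeanMapRegularity : Prop :=
  open Literature.MathematicalPhysics.KineticTheory Literature.Analysis.FluidPDE in ∃ η : ℝ, 0 < η ∧ ∀ (a₀ θ₀ : T3 → ℝ) (u₀ : T3 → V3), Continuous a₀ → Continuous θ₀ → Continuous u₀ → (∀ x, 0 < a₀ x) → (∀ x, 0 < θ₀ x) → ∃ σ₀ : ℝ, 0 < σ₀ ∧ ∀ σ : ℝ, 0 < σ → σ < σ₀ → ∀ (T : ℝ) (ρ θ : ℝ → T3 → ℝ) (u : ℝ → T3 → V3), IsHardSphereEulerSolution σ T ρ u θ → (∀ t ∈ Set.Ico 0 T, ∀ x, ρ t x * σ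 ^ 3 < η) → ∀ Φ : (N : ℕ) → HardSphereFlow (Torus.geometry (Fin 3)) (hsDiameter σ N) (N + 1), TendstoHydroFieldsAt (fun N => localGibbsLaw σ a₀ u₀ θ₀ N (Φ N)) Φ ρ u θ 0 → ∀ a : ℝ → T3 → ℝ, a 0 = a₀ → (∀ τ ∈ Set.Ico 0 T, Continuous (a τ) ∧ ∀ x, 0 < a τ x) → (∀ τ ∈ Set.Ico 0 T, ∀ χ : T3 → ℝ, Literature.Analysis.FunctionSpaces.Torus.IsSmooth χ → Tendsto (fun N : ℕ => ∫ z, empiricalDensityField z χ ∂(localGibbsLaw σ (a τ) (u τ) (θ τ) N (Φ N))) atTop (𝓝 (∫ x, χ x * ρ τ x)) ∧ (∀ j : Fin 3, Tendsto (fun N : ℕ => ∫ z, empiricalMomentumField z χ j ∂(localGibbsLaw σ (a τ) (u τ) (θ τ) N (Φ N))) atTop (𝓝 (∫ x, χ x * ρ τ x * u τ x j))) ∧ Tendsto (fun N : ℕ => ∫ z, empiricalEnergyField z χ ∂(localGibbsLaw σ (a τ) (u τ) (θ τ) N (Φ N))) atTop (𝓝 (∫ x, χ x * totalEnergyDensity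 (ρ τ x) (u τ x) (θ τ x)))) → ∀ t ∈ Set.Ico 0 T, ∀ χ : T3 → ℝ, Literature.Analysis.FunctionSpaces.Torus.IsSmooth χ → ∃ C : ℝ, ∃ e : ℕ → ℝ, Tendsto e atTop (𝓝 0) ∧ ∀ N : ℕ, ∀ s ∈ Set.Icc 0 t, ∀ τ ∈ Set.Icc 0 t, s + τ ≤ t → let P : Measure (Config (N + 1) (Fin 3) T3) := localGibbsLaw σ (a τ) (u τ) (θ τ) N (Φ N); |(∫ z, empiricalDensityField ((Φ N).flow s z) χ ∂P) - ∫ z, empiricalDensityField z χ ∂P| ≤ C * s + e N ∧ (∀ j : Fin 3, |(∫ z, empiricalMomentumField ((Φ N).flow s z) χ j ∂P) - ∫ z, empiricalMomentumField z χ j ∂P| ≤ C * s + e N) ∧ |(∫ z, empiricalEnergyField ((Φ N).flow s z) χ ∂P) - ∫ z, empiricalEnergyField z χ ∂P| ≤ C * s + e N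

/-- item stmt-AtomisticToContinuum-15331 · support · rank 9 · closed · proved by Summit.AtomisticToContinuum.HydrodynamicLimit.Theorems.RestartPrinciple.AgeDuhamelForgetting.stub_eulerProfileFamily (prover) · by planner
sources: Ruelle1969, LebowitzPenrose1964, Spohn1991
[support] EULER ACTIVITY FAMILY (statics + PDE): along every packing-guarded admissible classical
solution there is an activity family a_τ with a_0 = a₀ (canonical laws are invariant under a ↦ c·a),
continuous, positive, locally Lipschitz in τ, whose local Gibbs laws have time-0 mean fields
converging to the Euler fields at τ (inverse activity–density map of the low-density virial EOS
composed with the smooth solution; LLN of means for local Gibbs laws). [difficulty: M] -/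
@[route_item "route-AtomisticToContinuum-ResponseRigidity"]
def EulerProfileFamily : Prop :=
  open Literature.MathematicalPhysics.KineticTheory Literature.Analysis.FluidPDE in ∃ η : ℝ, 0 < η ∧ ∀ (a₀ θ₀ : T3 → ℝ) (u₀ : T3 → V3), Continuous a₀ → Continuous θ₀ → Continuous u₀ → (∀ x, 0 < a₀ x) → (∀ x, 0 < θ₀ x) → ∃ σ₀ : ℝ, 0 < σ₀ ∧ ∀ σ : ℝ, 0 < σ → σ < σ₀ → ∀ (T : ℝ) (ρ θ : ℝ → T3 → ℝ) (u : ℝ → T3 → V3), IsHardSphereEulerSolution σ T ρ u θ → (∀ t ∈ Set.Ico 0 T, ∀ x, ρ t x * σ ^ 3 < η) → ∀ Φ : (N : ℕ) → HardSphereFlow (Torus.geometry (Fin 3)) (hsDiameter σ N) (N + 1), TendstoHydroFieldsAt (fun N => localGibbsLaw σ a₀ u₀ θ₀ N (Φ N)) Φ ρ u θ 0 → ∃ a : ℝ → T3 → ℝ, a 0 = a₀ ∧ (∀ τ ∈ Set.Ico 0 T, Continuous (a τ) ∧ ∀ x, 0 < a τ x) ∧ (∀ T' : ℝ, T' < T →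 ∃ La : ℝ, ∀ τ ∈ Set.Icc 0 T', ∀ τ' ∈ Set.Icc 0 T', ∀ x, |a τ x - a τ' x| ≤ La * |τ - τ'|) ∧ (∀ τ ∈ Set.Ico 0 T, ∀ χ : T3 → ℝ, Literature.Analysis.FunctionSpaces.Torus.IsSmooth χ → Tendsto (fun N : ℕ => ∫ z, empiricalDensityField z χ ∂(localGibbsLaw σ (a τ) (u τ) (θ τ) N (Φ N))) atTop (𝓝 (∫ x, χ x * ρ τ x)) ∧ (∀ j : Fin 3, Tendsto (fun N : ℕ => ∫ z, empiricalMomentumField z χ j ∂(localGibbsLaw σ (a τ) (u τ) (θ τ) N (Φ N))) atTop (𝓝 (∫ x, χ x * ρ τ x * u τ x j))) ∧ Tendsto (fun N : ℕ => ∫ z, empiricalEnergyField z χ ∂(localGibbsLaw σ (a τ) (u τ) (θ τ) N (Φ N))) atTop (𝓝 (∫ x, χ x * totalEnergyDensity (ρ τ x) (u τ x) (θ τ x))))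

/-- item stmt-AtomisticToContinuum-15332 · support · rank 9 · open · by planner
sources: BarangerMouhot2005, Mouhot2006, CIP1994, Bremaud2020, LastPenrose2017, EfronStein1981
[support] THE ENGINE (renewal + rigidity + absorption; difficulty L, honest): SlavedContactSynergy →
CLTScaleConcentration → RenewalDefect → HydrodynamicSufficiency. Proof plan (checked on paper at
constant profiles): Lipschitz-in-lag from C2; Campbell/Palm renewal identity across one step of d
mean free times (C3 supplies the time shift off equilibrium; Lanford-type control for a FRACTION of
a mean free time gives the Palm law of the first collision under LG_τ); tower property; Hoeffding
split at OUTGOING contact; symmetrisation E_flux[(ψ(v)−ψ(v'))(μ(v')+μ(w'))] = ⟨ψ, Lμ⟩;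
self-adjointness, ker L = invariants, gap (BarangerMouhot2005), ‖μ₁‖₂ = O(1) by Bessel from C2,
absorption of the slaved term for ϵ below the gap. [difficulty: L] -/
@[route_item "route-AtomisticToContinuum-ResponseRigidity"]
def RigidityTransfer : Prop :=
  SlavedContactSynergy → CLTScaleConcentration → RenewalDefect → HydrodynamicSufficiency

/-- item stmt-AtomisticToContinuum-15333 · support · rank 9 · open · by planner
sources: Yau1991, OllaVaradhanYau1993, EvansMorriss2008, Sasa2014, Spohn1991
[support] SUFFICIENCY ⇒ FLOW BOX (difficulty L): HydrodynamicSufficiency → SlavedContactSynergy →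
CLTScaleConcentration → RenewalDefect → FlowBoxDecoupling. The exact score identities (∂_τ M =
Cov(profile score, Y), exponential family; ∂_s M = Cov(dynamical score, Y), Kawasaki/TTCF with the
collisional score as a contact-flux integral) and Yau's cancellation (the hydro projection of the
dynamical score is the Euler profile score up to o(1) statics, incl. the virial pressure) make the
flow-box defect Cov(⊥-score(0), Y_s); its kinetic part is ⟨Burnett, μ₁⟩ → 0 by sufficiency, its
collisional part a flux pairing of the transfer weight with μ₂, reduced by the same Hoeffding split
and slaving. [difficulty: L] -/
@[route_item "route-AtomisticToContinuum-ResponseRigidity"]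
def SufficiencyToFlowBox : Prop :=
  HydrodynamicSufficiency → SlavedContactSynergy → CLTScaleConcentration → RenewalDefect → FlowBoxDecoupling

/-- item stmt-AtomisticToContinuum-15334 · support · rank 9 · closed · proved by Summit.AtomisticToContinuum.HydrodynamicLimit.Theorems.RestartPrinciple.AgeDuhamelForgetting.meansByCharacteristics_holds (prover) · by planner
sources: Spohn1991
[support] MEANS BY CHARACTERISTICS (calculus + bookkeeping, provable now modulo its inputs):
FlowBoxDecoupling → MeanMapRegularity → EulerProfileFamily → MeanHydroLimitInBand, by the exact
antidiagonal telescope M(t,0) − M(0,t) = Σ_k [M((k+1)h, t−(k+1)h) − M(kh, t−kh)] (each summand a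
flow-box defect ≤ κh once kh ≥ δ; the layer kh < δ telescopes to M(δ,t−δ) − M(0,t), paid by
MeanMapRegularity and continuity of the Euler fields), η := min, σ₀ := min. [difficulty:
provable-now] -/
@[route_item "route-AtomisticToContinuum-ResponseRigidity"]
def MeansByCharacteristics : Prop :=
  FlowBoxDecoupling → MeanMapRegularity → EulerProfileFamily → MeanHydroLimitInBand

-- earlier Assembly (stmt-AtomisticToContinuum-15335, replaced 2026-08-16T23:27:23Z -> stmt-AtomisticToContinuum-17692): retired by None — SlavedContactSynergy → CLTScaleConcentration → RenewalDefect → EngineReduction → MeanClosure → DiluteSelfConsistency → _root_.HydrodynamicLimit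
/-- item stmt-AtomisticToContinuum-17692 · assembly · rank 1 · open · by planner
sources: Spohn1991, OllaVaradhanYau1993
[assembly] SlavedContactSynergy → CLTScaleConcentration → RenewalDefect → EngineReduction →
MeanClosure → the (packing-guarded) sub-problem statement; DiluteSelfConsistency dropped after the
2026-08-16 statement re-type (p126922): the conjunct now carries the packing guard as a hypothesis. -/
@[route_item "route-AtomisticToContinuum-ResponseRigidity"]
def Assembly : Prop :=
  SlavedContactSynergy → CLTScaleConcentration → RenewalDefect → EngineReduction → MeanClosure → _root_.HydrodynamicLimit

/-! D-0027 §2.1 — DECIDING THEOREM (planner-authored via `route open/edit --closes-file`; by planner-rbadge-AtomisticToContinuum-ResponseRi-f49d0d68-0 2026-08-16T23:41:03Z):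
its hypotheses are this route's items and its conclusion the sub-problem Statement (glue_lint), and it elaborates with this file. -/

@[closes "route-AtomisticToContinuum-ResponseRigidity"] theorem closes (h₂ : SlavedContactSynergy) (h₃ : CLTScaleConcentration) (h₄ : RenewalDefect)
    (hE : EngineReduction) (hM : MeanClosure) :
    _root_.HydrodynamicLimit := by
  -- X_mean := the engine applied to the three cruxes
  have hX : MeanHydroLimitInBand := hE h₂ h₃ h₄
  obtain ⟨η₁, hη₁, H₁⟩ := hX
  obtain ⟨η₂, hη₂, H₂⟩ := hM
  -- packing threshold of the (re-typed 2026-08-16, packing-guarded) conjunct := the smaller of the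
  -- two item bands (MeanHydroLimitInBand's and MeanClosure's)
  refine ⟨min η₁ η₂, lt_min hη₁ hη₂, ?_⟩
  intro a₀ θ₀ u₀ ha hθ hu ha0 hθ0
  obtain ⟨σ₁, hσ₁, G₁⟩ := H₁ a₀ θ₀ u₀ ha hθ hu ha0 hθ0
  obtain ⟨σ₂, hσ₂, G₂⟩ := H₂ a₀ θ₀ u₀ ha hθ hu ha0 hθ0
  refine ⟨min σ₁ σ₂, lt_min hσ₁ hσ₂, ?_⟩
  intro σ hσ hσ' T ρ θ u hsol hpack Φ h0 t ht
  have h1 : σ < σ₁ := lt_of_lt_of_le hσ' (min_le_left _ _)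
  have h2 : σ < σ₂ := lt_of_lt_of_le hσ' (min_le_right _ _)
  -- the conjunct's own packing guard (a hypothesis since the re-type) feeds both items' guards
  have hp1 : ∀ s ∈ Set.Ico 0 T, ∀ x, ρ s x * σ ^ 3 < η₁ :=
    fun s hs x => lt_of_lt_of_le (hpack s hs x) (min_le_left _ _)
  have hp2 : ∀ s ∈ Set.Ico 0 T, ∀ x, ρ s x * σ ^ 3 < η₂ :=
    fun s hs x => lt_of_lt_of_le (hpack s hs x) (min_le_right _ _)
  -- means at t from X_mean, probability at t from MeanClosure
  exact G₂ σ hσ h2 T ρ θ u hsol hp2 Φ h0 t ht (G₁ σ hσ h1 T ρ θ u hsol hp1 Φ h0 t ht)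

end Summit.AtomisticToContinuum.HydrodynamicLimit.Theses.ResponseRigidity
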